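import Literature.NumberTheory.Automorphic.ArchOrbitMeasurePartialTestFunction       -- ★ (R1-a) (this seat): `exists_contDiff_eq_integral_insert`
import HarnessLib

/-!
# Orbit-measure Fubini on `G′_∞ = Π_v G_v`: split one place off a finite product of ARBITRARY measures on the `G_v`, and read the orbit-currency state as the
# `w`-conjugation integral of the mixed partial integral ((R1-b′) of R1 «(L-use) at all indefinite places»; Borel–Jacquet §4.1, Rogawski 1990 §8.2–8.3)

Topic `NumberTheory/Automorphic`; namespace `Literature.NumberTheory.Automorphic.UnitaryGroup`.  THEOREMS ONLY (no `def`, no instance, no notation, no axiom, no `sorry`).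
Cell `pub/hodgecm-mathlib`, ENGINE T1 (crux H413 = `stmt-HodgeConjecture-24833`); floor-2 road «(J-nc) in-house», brick (R1-b′) of R1 `stub_LuseAllPlaces` (LEAD F0P3a-plan (g9) WORDS
T8-53 ∕ T8-57 ∕ T8-61; census `CENSUS-R1-LuseAllPlaces` 8d436054; author F0P3a-p07 (g7), 2026-09-01).  `N`-GENERAL (shared with F0P3a-p02's (R3-c) at the centre, T8-61 (C1)).

THE ORBIT-MEASURE CURRENCY OF R1.  The split-singular rational point `γ₀ ⊗ 1` is taken to the wall ONE PLACE AT A TIME; after the places `S` have been processed the state is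
`∫ Θ ↑↑(e⁻¹ o) d(⊗_v μ_v)(o)` with ARBITRARY Radon measures `μ_v` on the `G_v` — orbit measures: quotient-measure push-forwards at noncompact walls, Haar push-forwards at compact
walls ∕ definite places, and at the place `w` about to move the REGULAR orbit measure `ν.map (y ↦ y·d·y⁻¹)`.  The one-step jump at `w` is then J1 (★ p840417, unconditional ★ p840906)
applied to the MIXED PARTIAL integral `MP(x) = ∫ Θ ↑↑(e⁻¹(x, o′)) d(⊗_{v≠w} μ_v)(o′)`, which ★ (R1-a) p841031 `exists_contDiff_eq_integral_insert` makes the restriction of a per-place test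
function `Θ′` (a five-line `obtain … funext … rw … exact` at each use — deliberately NOT a module: it is J1 verbatim at `Θ ↦ MP`).  THIS FILE supplies the two measure-theoretic
identities that move between the all-places state and the `w`-integral of `MP`:
* `integral_pi_eq_integral_integral_assemble` — `∫ F d(⊗_v μ_v) = ∫_{G_w} ∫ F(assemble(x, o′)) d(⊗_{v≠w} μ_v)(o′) dμ_w(x)` for σ-finite `μ_v` and integrable `F` (★ (V7) (h2) steps 2–3
  made generic in the measures: Mathlib `measurePreserving_piEquivPiSubtypeProd`, `measurePreserving_piUnique`, `integral_prod`);
* `integral_pi_eq_integral_mixedPartial_comp_conj` — with `μ_w = ν.map (y ↦ y·d·y⁻¹)`: `∫ Θ ↑↑(e⁻¹ o) d(⊗_v μ_v) = ∫_{G_w} MP(y·d·y⁻¹) dν(y)` for a global test function `Θ`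
  (integrability from compact support; `integral_map` along the conjugation, `MP` continuous by ★ (R1-a)).
HONEST LABEL: HC_CM is proved only modulo the 7 printed citations until rung 0 closes; this file is measure-theoretic bookkeeping and pays nothing by itself.

## References
* [BorelJacquet1979] A. Borel, H. Jacquet, *Automorphic forms and automorphic representations*, PSPM 33.1 (1979), §4.1 (`G_∞ = Π_v G(F_v)`, product measures).
* [Rogawski1990] J. D. Rogawski, *Automorphic Representations of Unitary Groups in Three Variables*, Ann. of Math. Stud. 123 (1990), §8.2 p. 122–124, §8.3 p. 122,
  §14.5 p. 238–239 (one place at a time).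
* [DeitmarEchterhoff2014] A. Deitmar, S. Echterhoff, *Principles of Harmonic Analysis*, 2nd ed. (2014), Thm. 1.5.3, Lemma 9.3.3.
-/

set_option autoImplicit false

noncomputable section

open MeasureTheory Measure Filter Topology NumberField NumberField.InfinitePlace NumberField.mixedEmbedding Equiv Function Set
open Literature.MeasureTheory.Group Literature.NumberTheory.Automorphic Literature.NumberTheory.Automorphic.UnitaryGroup
open Literature.LinearAlgebra.Matrix
open scoped Matrix MatrixGroups Matrix.Norms.Operator ContDiff

namespace Literature.NumberTheory.Automorphic.UnitaryGroup

/-! ## §1 Orbit-measure Fubini (`N`-general): split one place off a finite product of ARBITRARY measures on the `G_v` -/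

section OrbitFubini

variable (L : Type) [Field L] [NumberField L] [IsCMField L] (N : ℕ) (α : Fin N → L) (w : {w : InfinitePlace L // IsComplex w})
  [∀ v : {w : InfinitePlace L // IsComplex w}, MeasurableSpace (archLocal L N (Matrix.diagonal α) v)]
  [∀ v : {w : InfinitePlace L // IsComplex w}, BorelSpace (archLocal L N (Matrix.diagonal α) v)]

omit [IsCMField L] [∀ v : {w : InfinitePlace L // IsComplex w}, BorelSpace (archLocal L N (Matrix.diagonal α) v)] in
open scoped Classical in
/-- **SPLIT ONE PLACE OFF A PRODUCT OF MEASURES ON THE `G_v`**: for σ-finite measures `μ_v` on the `G_v` and `F` integrable for `⊗_v μ_v`,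
`∫ F d(⊗_v μ_v) = ∫_{G_w} ∫ F(assemble(x, o′)) d(⊗_{v≠w} μ_v)(o′) dμ_w(x)` with the assembly written through Mathlib's `piEquivPiSubtypeProd (· = w)` and `piUnique`
(★ (V7) (h2) steps 2–3, made generic in the measures: ★ `measurePreserving_piEquivPiSubtypeProd`, `measurePreserving_piUnique`, `integral_prod`). [cite: BorelJacquet1979, §4.1] -/
theorem integral_pi_eq_integral_integral_assemble {E : Type*} [NormedAddCommGroup E] [NormedSpace ℝ E]
    (μall : ∀ v : {w : InfinitePlace L // IsComplex w}, Measure (archLocal L N (Matrix.diagonal α) v)) [∀ v, SigmaFinite (μall v)]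
    (F : (∀ v : {w : InfinitePlace L // IsComplex w}, archLocal L N (Matrix.diagonal α) v) → E) (hF : Integrable F (Measure.pi μall)) :
    ∫ o, F o ∂(Measure.pi μall) =
      ∫ x : archLocal L N (Matrix.diagonal α) w, (∫ o' : (∀ w' : {v : {w : InfinitePlace L // IsComplex w} // ¬ v = w}, archLocal L N (Matrix.diagonal α) w'.1),
        F ((MeasurableEquiv.piEquivPiSubtypeProd (fun v : {w : InfinitePlace L // IsComplex w} => ↥(archLocal L N (Matrix.diagonal α) v)) (· = w)).symm
          ((MeasurableEquiv.piUnique fun i : {v : {w : InfinitePlace L // IsComplex w} // v = w} => ↥(archLocal L N (Matrix.diagonal α) i.1)).symm x, o')) ∂(Measure.pi fun w' : {v : {w : InfinitePlace L // IsComplex w} // ¬ v = w} => μall w'.1)) ∂(μall w) := by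
  have hψ' := measurePreserving_piEquivPiSubtypeProd (fun v => μall v) (· = w)
  have h2 := (hψ'.symm.integral_comp' F).symm
  have hFi' : Integrable (fun q => F ((MeasurableEquiv.piEquivPiSubtypeProd
      (fun v : {w : InfinitePlace L // IsComplex w} => ↥(archLocal L N (Matrix.diagonal α) v)) (· = w)).symm q)) _ :=
    (hψ'.symm.integrable_comp_emb (MeasurableEquiv.measurableEmbedding _)).mpr hF
  rw [h2, integral_prod _ hFi']
  have hu' : MeasurePreserving (MeasurableEquiv.piUnique fun i : {v : {w : InfinitePlace L // IsComplex w} // v = w} => ↥(archLocal L N (Matrix.diagonal α) i.1))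
      (@Measure.pi {v : {w : InfinitePlace L // IsComplex w} // v = w} (fun i => ↥(archLocal L N (Matrix.diagonal α) i.1))
        (Subtype.fintype fun x => x = w) (fun i => inferInstance) (fun i => μall i.1)) (μall w) := by
    convert measurePreserving_piUnique (fun i : {v : {w : InfinitePlace L // IsComplex w} // v = w} => μall i.1) <;>
      exact ((default : {v : {w : InfinitePlace L // IsComplex w} // v = w}).2).symm
  rw [← hu'.symm.integral_comp']
  rfl

open scoped Classical in
/-- **THE ORBIT-CURRENCY STATE IS THE `w`-CONJUGATION INTEGRAL OF THE MIXED PARTIAL INTEGRAL**: if the measure at `w` is the REGULAR ORBIT MEASURE `μ_w = ν.map (y ↦ y·d·y⁻¹)` of a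
point `d ∈ G_w` under a measure `ν` (the other `μ_v`, `v ≠ w`, arbitrary finite on compacts), then for a global test function `Θ` (continuous, compact support on `G′_∞`)
`∫ Θ ↑↑(e⁻¹ o) d(⊗_v μ_v)(o) = ∫_{G_w} MP(y·d·y⁻¹) dν(y)`, `MP(x) = ∫ Θ ↑↑(e⁻¹(x, o′)) d(⊗_{v≠w} μ_v)(o′)` (★ (R1-a)'s mixed partial integral) — the glue between two steps of the
place-by-place induction (§2 consumes the right-hand side, produces orbit measures at `w`, and the next place reads the left-hand side again). [cite: BorelJacquet1979, §4.1]
[cite: Rogawski1990, §8.3 p. 122] -/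
theorem integral_pi_eq_integral_mixedPartial_comp_conj {E : Type*} [NormedAddCommGroup E] [NormedSpace ℝ E] [CompleteSpace E]
    (hα : ∀ i, α i ≠ 0)
    (μall : ∀ v : {w : InfinitePlace L // IsComplex w}, Measure (archLocal L N (Matrix.diagonal α) v)) [∀ v, IsFiniteMeasureOnCompacts (μall v)] [∀ v, SigmaFinite (μall v)]
    (ν : Measure (archLocal L N (Matrix.diagonal α) w)) [IsFiniteMeasureOnCompacts ν] [SigmaFinite ν] (d : archLocal L N (Matrix.diagonal α) w)
    (hμw : μall w = ν.map fun y : archLocal L N (Matrix.diagonal α) w => y * d * y⁻¹)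
    (Θ : Matrix (Fin N) (Fin N) (mixedSpace L) → E) (hΘ : ContDiff ℝ (⊤ : ℕ∞) Θ)
    (hΘc : HasCompactSupport fun g : arch (↥(maximalRealSubfield L)) L (IsCMField.complexConj L) N (Matrix.diagonal α) => Θ ((g : GL (Fin N) (mixedSpace L)) : Matrix (Fin N) (Fin N) (mixedSpace L))) :
    ∫ o, Θ ((((archPiEquivCM N L (Matrix.diagonal α)).symm o : arch (↥(maximalRealSubfield L)) L (IsCMField.complexConj L) N (Matrix.diagonal α)) : GL (Fin N) (mixedSpace L)) : Matrix (Fin N) (Fin N) (mixedSpace L)) ∂(Measure.pi μall) =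
      ∫ y : archLocal L N (Matrix.diagonal α) w,
        (fun x : archLocal L N (Matrix.diagonal α) w =>
          ∫ o' : (∀ w' : {v : {w : InfinitePlace L // IsComplex w} // ¬ v = w}, archLocal L N (Matrix.diagonal α) w'.1),
            Θ ((((archPiEquivCM N L (Matrix.diagonal α)).symm ((MeasurableEquiv.piEquivPiSubtypeProd (fun v : {w : InfinitePlace L // IsComplex w} => ↥(archLocal L N (Matrix.diagonal α) v)) (· = w)).symm
          ((MeasurableEquiv.piUnique fun i : {v : {w : InfinitePlace L // IsComplex w} // v = w} => ↥(archLocal L N (Matrix.diagonal α) i.1)).symm x, o')) : arch (↥(maximalRealSubfield L)) L (IsCMField.complexConj L) N (Matrix.diagonal α)) : GL (Fin N) (mixedSpace L)) : Matrix (Fin N) (Fin N) (mixedSpace L))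
            ∂(Measure.pi fun w' : {v : {w : InfinitePlace L // IsComplex w} // ¬ v = w} => μall w'.1))
        (y * d * y⁻¹) ∂ν := by
  haveI : ∀ v : {w : InfinitePlace L // IsComplex w}, LocallyCompactSpace (archLocal L N (Matrix.diagonal α) v) := fun v => locallyCompactSpace_archLocal L N (Matrix.diagonal α) v
  haveI : ∀ v : {w : InfinitePlace L // IsComplex w}, SecondCountableTopology (archLocal L N (Matrix.diagonal α) v) := fun v => secondCountableTopology_archLocal L N (Matrix.diagonal α) v
  -- the integrand on `Π_v G_v` is continuous with compact support, hence integrable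
  have hF : Integrable (fun o : ∀ v : {w : InfinitePlace L // IsComplex w}, archLocal L N (Matrix.diagonal α) v =>
      Θ ((((archPiEquivCM N L (Matrix.diagonal α)).symm o : arch (↥(maximalRealSubfield L)) L (IsCMField.complexConj L) N (Matrix.diagonal α)) : GL (Fin N) (mixedSpace L)) : Matrix (Fin N) (Fin N) (mixedSpace L))) (Measure.pi μall) := by
    have hc : Continuous fun g : arch (↥(maximalRealSubfield L)) L (IsCMField.complexConj L) N (Matrix.diagonal α) => Θ ((g : GL (Fin N) (mixedSpace L)) : Matrix (Fin N) (Fin N) (mixedSpace L)) :=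
      hΘ.continuous.comp (Units.continuous_val.comp continuous_subtype_val)
    exact (hc.comp (archPiEquivCM N L (Matrix.diagonal α)).symm.continuous).integrable_of_hasCompactSupport
      (hΘc.comp_homeomorph (archPiEquivCM N L (Matrix.diagonal α)).symm.toHomeomorph)
  rw [integral_pi_eq_integral_integral_assemble L N α w μall _ hF, hμw]
  -- the mixed partial integral is continuous (★ (R1-a): it is the restriction of a smooth `Θ′`), so `integral_map` applies
  obtain ⟨Θ', hΘ'd, -, hΘ'eq⟩ := exists_contDiff_eq_integral_insert L N α hα w (fun w' : {v : {w : InfinitePlace L // IsComplex w} // ¬ v = w} => μall w'.1) Θ hΘ hΘc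
  have hMP : (fun x : archLocal L N (Matrix.diagonal α) w =>
      ∫ o' : (∀ w' : {v : {w : InfinitePlace L // IsComplex w} // ¬ v = w}, archLocal L N (Matrix.diagonal α) w'.1),
        Θ ((((archPiEquivCM N L (Matrix.diagonal α)).symm ((MeasurableEquiv.piEquivPiSubtypeProd (fun v : {w : InfinitePlace L // IsComplex w} => ↥(archLocal L N (Matrix.diagonal α) v)) (· = w)).symm
          ((MeasurableEquiv.piUnique fun i : {v : {w : InfinitePlace L // IsComplex w} // v = w} => ↥(archLocal L N (Matrix.diagonal α) i.1)).symm x, o')) : arch (↥(maximalRealSubfield L)) L (IsCMField.complexConj L) N (Matrix.diagonal α)) : GL (Fin N) (mixedSpace L)) : Matrix (Fin N) (Fin N) (mixedSpace L))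
        ∂(Measure.pi fun w' : {v : {w : InfinitePlace L // IsComplex w} // ¬ v = w} => μall w'.1)) =
      fun x : archLocal L N (Matrix.diagonal α) w => Θ' ((x : GL (Fin N) ℂ) : Matrix (Fin N) (Fin N) ℂ) := funext fun x => (hΘ'eq x).symm
  have hcont : Continuous fun x : archLocal L N (Matrix.diagonal α) w => Θ' ((x : GL (Fin N) ℂ) : Matrix (Fin N) (Fin N) ℂ) :=
    hΘ'd.continuous.comp (Units.continuous_val.comp continuous_subtype_val)
  have hconj : Measurable fun y : archLocal L N (Matrix.diagonal α) w => y * d * y⁻¹ := ((continuous_id.mul continuous_const).mul continuous_id.inv).measurable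
  rw [hMP, integral_map hconj.aemeasurable hcont.aestronglyMeasurable]

end OrbitFubini

end Literature.NumberTheory.Automorphic.UnitaryGroup

end
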